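import Summits.CriticalPhenomena.Ising3D.Control2DRecordNonVacuity
import Summits.CriticalPhenomena.Ising3D.Control2DVertexNonVacuity
import Mathlib.Tactic.NormNum
import HarnessLib

/-!
# The 2D control's record next to BOTH witnesses (one import for a referee)
(cell `pub-ising3x`, seat controls-1 gen 36; CONTROL-ONLY)

HONEST FRAMING: lottery ticket; floor = tightest certified 3D Ising CFT bounds; no exact-solution
claim without a proof. CONTROL-ONLY (`d = 2`, `Δ_σ = 1/8`); nothing new is proved here beyond conjunctions
and elementary arithmetic — the conjuncts are the theorems of record of `Control2DRecord` (the certified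
exclusions), `Control2DNonVacuity` (the generalised-free-field witness) and `Control2DVertexNonVacuity` (the
free-boson witness, `c = 1`, WITH a stress tensor).

* `record_gapThreshold_window_half` — `¬ GapExcluded (1/8) (1/2) ∧ GapExcluded (1/8) (20001/20000)`: the
  threshold of the typed one-sided item ("`Δ_ε < U` for every unitary crossing-symmetric datum at
  `Δ_σ = 1/8`") lies in `(1/2, 1.00005]` (the free field gave `(1/4, 1.00005]`, `record_gapThreshold_window`);
* `record_gapThreshold_rays_half` — the two rays: `U ≤ 1/2 ⇒ ¬ GapExcluded (1/8) U`,
  `U ≥ 20001/20000 ⇒ GapExcluded (1/8) U`;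
* `control2D_record_witnesses` — (∃ free-field datum, gap `1/4`) ∧ (∃ free-boson datum, gap `1/2`, stress
  tensor with total `(2,2)` coefficient `1/128 = (1/8)²/(2·1)`) ∧ the `Λ = 19` rungs of the record.

References: R. Rattazzi, V. S. Rychkov, E. Tonni, A. Vichi, JHEP 12 (2008) 031, §5 [cite: RattazziEtAl2008, §5];
Ph. Di Francesco, P. Mathieu, D. Sénéchal, Conformal Field Theory (Springer 1997), §9.1
[cite: DiFrancescoMathieuSenechal1997, §9.1].
-/

namespace Summit.CriticalPhenomena.Ising3D.Control2D

/-- **The one-sided threshold window, sharpened**: `¬ GapExcluded (1/8) (1/2)` (free-boson witness) and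
`GapExcluded (1/8) (20001/20000)` (`Λ = 19` certificate of record). [folklore] -/
theorem record_gapThreshold_window_half :
    ¬ GapExcluded (1 / 8 : ℝ) (1 / 2) ∧ GapExcluded (1 / 8 : ℝ) (20001 / 20000) :=
  ⟨not_gapExcluded_2d_half, record_oneSided.2.2.2.2.2⟩

/-- The two rays: no gap `U ≤ 1/2` is excludable at `Δ_σ = 1/8`; every gap `U ≥ 20001/20000` is excluded.
[folklore] -/
theorem record_gapThreshold_rays_half (U : ℝ) :
    (U ≤ 1 / 2 → ¬ GapExcluded (1 / 8 : ℝ) U) ∧ (20001 / 20000 ≤ U → GapExcluded (1 / 8 : ℝ) U) :=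
  ⟨fun hU => not_gapExcluded_of_le_vertex (s := 1 / 8) (by norm_num)
      (by rw [show min (4 * (1 / 8 : ℝ)) 2 = 1 / 2 by norm_num]; exact hU),
    fun hU => record_oneSided.2.2.2.2.2.mono hU⟩

/-- **Record ∧ witnesses in one theorem**: the base class inhabited by the free field (gap `1/4`), the
stress-tensor class inhabited by the free boson (gap `1/2`, spin 2 in `{2} ∪ [5/2, ∞)`, total `(2,2)`
coefficient `1/128`), and the `Λ = 19` one-sided and class-1 rungs of record. [folklore] -/
theorem control2D_record_witnesses :
    (∃ D : CrossingData, D.IsUnitary ∧ D.SatisfiesCrossing (1 / 8 : ℝ) ∧ D.HasScalarGap (1 / 4)) ∧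
    (∃ D : CrossingData, D.IsUnitary ∧ D.SatisfiesCrossing (1 / 8 : ℝ) ∧ D.HasScalarGap (1 / 2) ∧
        D.SpinTwoIn ({2} ∪ Set.Ici (5 / 2)) ∧ D.stressCoeff = 1 / 128) ∧
    GapExcluded (1 / 8 : ℝ) (20001 / 20000) ∧
    (∀ w : ℝ, TwoSided (1 / 8 : ℝ) 2 1 w (99 / 100) (20001 / 20000)) := by
  refine ⟨crossingData_nonvacuous_eighth, ?_, record_oneSided.2.2.2.2.2, record_twoSided.2.2.2.2.2⟩
  obtain ⟨D, h1, h2, h3, h4, h5⟩ := crossingData_nonvacuous_stress (s := (1 / 8 : ℝ)) (by norm_num)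
  refine ⟨D, h1, h2, ?_, ?_, ?_⟩
  · rw [show min (4 * (1 / 8 : ℝ)) 2 = 1 / 2 by norm_num] at h3; exact h3
  · rw [show (2 : ℝ) + min 2 (4 * (1 / 8 : ℝ)) = 5 / 2 by norm_num] at h4; exact h4
  · rw [h5]; norm_num

end Summit.CriticalPhenomena.Ising3D.Control2D
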